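import Summits.RiemannHypothesis.RiemannHypothesis.Theorems.TiltedLandingLaw421R3TouchedDissipation

/-!
# T⁗ — the FRAME-WEIGHTED log-profile dissipation SOCKET `TouchedDissipationLawWQ cF L κ₀` and its instance `TouchedDissipationLawTQ c L κ₀ θ`
(lens-2 g7; TYPED per (CA680)(D2) after CUT 34; memo `lens2/TQ-FRAMEWISE-MEMO-v1.md` ad1b401b, decldiff `lens2/GLUE-V5-DECLDIFF-v1.md` f8dc3f57; a LAW, unproved)
ONE tree import (C′ module `…R3TouchedDissipation`, #1178).  Self-contained: the log weight `logWeight` of the dead T‴ draft (`lens2/TouchedDissipationL-v1.lean`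
64d6c277, never landed) is re-homed here (§1).  PARAMETERS: `c` (dissipation constant), `L` (log slope), `κ₀` (field floor) — binders; `θ` (weight slope) a
binder of the general instance, with the value of record `thetaW = 2` a binder-free def (§1, justified there); NOTHING ELSE BAKED.
STATEMENT.  Same population as C′/T‴ (legal frame; CHARGED APPROACH level `j`; lowest band state `v` touched by a strictly taller zero `z` of `f⁽ʲ⁾`; the
pair atomic; `κ₀ ≤ Im v·κ_v`); with `e := Im v² + Im z²`, `y(e) := 1 + L·log(2Hs²/e)`:   `cF(F)·s² ≤ η²·y(e)²·(e − childEnergy Ū)`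
— T‴'s inequality VERBATIM with the global constant `c` replaced by a FRAME FUNCTIONAL `cF : Budget` (a function of the datum `(η,f,x₀,s,hmax,R,Hs,B)`
only, like every budget of the books).  [Erratum to the decldiff's one-liner, which put `y²` on the left: the benches' merit is `M_row(L) = X″·y²`, so `y²`
multiplies `ΔE`, as in T‴ and in the glue's paying inequality.]  T⁗ = the instance `cF := c / w_F`, `w_F := max(1, θ·(B+1)·(s/Hs)²)` (`frameWeightQ`):
big-`B` frames (one-sided fences, towers: B ≈ 60–110·(Hs/s)²) get the SMALL constant; balanced frames (`w_F = 1`) must carry `c` itself.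
BENCH OF RECORD (crit-1 CUT 34, (CA680), floats): decision number min over LEGAL ∧ CHARGED rows of `M_row(L)·w_F/need(.66, L)` = ×4.2 (row «W2F», L = 0)
among balanced frames, ≥ ×30 among one-sided frames; my predicted killer «W2F-tall» was neither legal nor charged; next adversary named: «W2F-sparse» (l.8232).
KILL: a legal charged atomic approach β-row with `X″·y_L(u)²·w_F < c` at the instance under test.
Nothing here bears on the truth of RH; RH is not proved; T⁗ is a typed LAW (OPEN), it survived ONE cut as a candidate; T″/T‴ dead; C′ typed not proved;
★A / 33346 / 33347 OPEN; checked ≠ landed ≠ proved. -/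

namespace RhW08.TouchedDissipationW

open Complex
open scoped ComplexConjugate
open RhW08.Round1 RhW08.StSwap RhW08.Round2 RhW08.QuadW
open RhW08.SealSwap (PBot)
open RhW08.SealSwapQ RhW08.RateSplit RhW08.BurgersRate RhW08.BurgersRateG3 RhW08.TouchedDissipation
open RhIdea6.G17.W07C7 RhIdea6.G17.W07C7.Rev6 RhIdea6.G18.W07C8.Law421BirthS RhIdea6.G19.W07C11.Seam
open RhIdea6.G20.W07C12.Frac RhIdea6.G20.W07C12.StColP RhW07.C12.FieldSplit RhIdea6.G21.W07C13.TentMax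
open RhW07.C14.TwoSided RhW07.C14.Classes RhW07.C14.Lineage RhW07.C14.Booking

/-! ## §1 Weights -/

/-- §1 the LOG-PROFILE WEIGHT `y(E) = 1 + L·log(2Hs²/E)` of an energy `E` in a strip of height `Hs` (`= 1` at `E = 2Hs²`; Lean junk: `E = 0 ⇒ y = 1`). -/
noncomputable def logWeight (L Hs E : ℝ) : ℝ := 1 + L * Real.log (2 * Hs ^ 2 / E)

/-- §1 the FRAME WEIGHT `w_F := max(1, θ·(B+1)·(s/Hs)²)` — a `Budget` (function of the frame datum only); `≥ 1`; reads `1` whenever `θ·(B+1) ≤ (Hs/s)²`. -/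
noncomputable def frameWeightQ (θ : ℝ) : Budget := fun _η _f _x₀ s _hmax _R Hs B => max 1 (θ * ((B : ℝ) + 1) * (s / Hs) ^ 2)

/-- §1 the WEIGHTED CONSTANT `c_F := c / w_F`. -/
noncomputable def weightedConstQ (c θ : ℝ) : Budget := fun η f x₀ s hmax R Hs B => c / frameWeightQ θ η f x₀ s hmax R Hs B

/-- §1 the weight slope OF RECORD `θ_W := 2` (binder-free).  WHY THIS VALUE, and why it is not a hand-picked truth threshold (checklist 4c(iv)): the law
`TouchedDissipationLawTQ c L κ₀ θ` is WEAKER for LARGER `θ` (`lawTQ_mono_theta`), so `θ` is capped only by what the BOOKS can pay: FIT_W's B-bracket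
(`approachBudgetHalfQ` carries `(3/2)·(B+1)` of capital per frame, `approachBudgetHalf_apply`) reads `φ₀·θ ≤ 3/2` with `φ₀ = (1+2L+2L²)/(2c)`, i.e.
`θ ≤ 3/(2φ₀) ∈ [2, 2.5]` on the purse factors of record `φ₀ ∈ [0.6, 0.75]`; `2` is the largest value payable across that whole range.  Any other `θ` is
another INSTANCE of the socket, not an edit of this file. -/
def thetaW : ℝ := 2

/-! ## §2 The socket and the law (parameters only; nothing instantiated numerically except `thetaW`) -/

/-- (SOCKET W — FRAME-WEIGHTED LOG-PROFILE DISSIPATION ON TOUCHED APPROACH LEVELS; typed, OPEN) for a frame functional `cF`: on a legal frame, at a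
CHARGED APPROACH level `j` whose lowest band state `v` is touched by a strictly taller zero `z` of `f⁽ʲ⁾` (`Touches`), the pair atomic (`AtomicPair`),
the state field above the floor (`κ₀ ≤ Im v·κ_v`): `cF(F)·s² ≤ η²·(1 + L·log(2Hs²/(Im v² + Im z²)))²·((Im v² + Im z²) − childEnergy(Ū))`. -/
def TouchedDissipationLawWQ (cF : Budget) (L κ₀ : ℝ) : Prop :=
  ∀ (η : ℝ) (f : ℂ → ℂ) (x₀ s hmax R Hs : ℝ) (B : ℕ), EngineHyps5 2 η f x₀ s hmax R Hs B →
    ∀ (j : ℕ) (v z : ℂ), Charged (PTrkSQ PBot) StTrkDQ ReadyR2 η f x₀ s hmax R Hs B j → ApproachLevelQ η f x₀ s hmax R Hs B j →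
      IsLowest StTrkDQ η f x₀ s hmax R Hs B j v → Touches f j v z → AtomicPair f j v z →
      κ₀ ≤ v.im * stateKappa f j v →
      cF η f x₀ s hmax R Hs B * s ^ 2
        ≤ η ^ 2 * logWeight L Hs (v.im ^ 2 + z.im ^ 2) ^ 2 * ((v.im ^ 2 + z.im ^ 2) - childEnergy f j (pairUnion v z))

/-- (LAW T⁗(c, L, κ₀, θ) — typed, OPEN) the socket at the weighted constant `c / max(1, θ·(B+1)·(s/Hs)²)`. -/
def TouchedDissipationLawTQ (c L κ₀ θ : ℝ) : Prop := TouchedDissipationLawWQ (weightedConstQ c θ) L κ₀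

/-- (LAW T⁗ OF RECORD — `θ = thetaW = 2`; `c, L, κ₀` parameters) -/
def TouchedDissipationLawTWQ (c L κ₀ : ℝ) : Prop := TouchedDissipationLawTQ c L κ₀ thetaW

/-! ## §3 Bookkeeping (K) -/

/-- (K) `y(2Hs²) = 1` (also for `Hs = 0`). -/
theorem logWeight_top (L Hs : ℝ) : logWeight L Hs (2 * Hs ^ 2) = 1 := by
  unfold logWeight
  by_cases h : 2 * Hs ^ 2 = 0
  · rw [h]; simp
  · rw [div_self h, Real.log_one]; ring

/-- (K) `1 ≤ y(E)` for `0 ≤ L`, `0 < E ≤ 2Hs²`. -/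
theorem one_le_logWeight {L Hs E : ℝ} (hL : 0 ≤ L) (hE : 0 < E) (hEA : E ≤ 2 * Hs ^ 2) : 1 ≤ logWeight L Hs E := by
  unfold logWeight
  have hlog : 0 ≤ Real.log (2 * Hs ^ 2 / E) := Real.log_nonneg ((one_le_div hE).2 hEA)
  nlinarith

/-- (K) `1 ≤ w_F`, hence `0 < w_F`. -/
theorem one_le_frameWeightQ (θ η : ℝ) (f : ℂ → ℂ) (x₀ s hmax R Hs : ℝ) (B : ℕ) : 1 ≤ frameWeightQ θ η f x₀ s hmax R Hs B :=
  le_max_left _ _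

theorem frameWeightQ_pos (θ η : ℝ) (f : ℂ → ℂ) (x₀ s hmax R Hs : ℝ) (B : ℕ) : 0 < frameWeightQ θ η f x₀ s hmax R Hs B :=
  one_pos.trans_le (one_le_frameWeightQ θ η f x₀ s hmax R Hs B)

/-- (K) `w_F ≤ 1 + θ·(B+1)·(s/Hs)²` for `0 ≤ θ` (the form FIT_W's two brackets use). -/
theorem frameWeightQ_le {θ : ℝ} (hθ : 0 ≤ θ) (η : ℝ) (f : ℂ → ℂ) (x₀ s hmax R Hs : ℝ) (B : ℕ) :
    frameWeightQ θ η f x₀ s hmax R Hs B ≤ 1 + θ * ((B : ℝ) + 1) * (s / Hs) ^ 2 := by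
  have h0 : 0 ≤ θ * ((B : ℝ) + 1) * (s / Hs) ^ 2 := by positivity
  exact max_le (by linarith) (by linarith)

/-- (K) `w_F` is monotone in `θ`. -/
theorem frameWeightQ_mono {θ θ' : ℝ} (hθ : θ ≤ θ') (η : ℝ) (f : ℂ → ℂ) (x₀ s hmax R Hs : ℝ) (B : ℕ) :
    frameWeightQ θ η f x₀ s hmax R Hs B ≤ frameWeightQ θ' η f x₀ s hmax R Hs B :=
  max_le_max le_rfl (mul_le_mul_of_nonneg_right (mul_le_mul_of_nonneg_right hθ (by positivity)) (sq_nonneg _))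

/-- (K) `0 < c ⇒ 0 < c_F`, and `0 ≤ c ⇒ c_F ≤ c`. -/
theorem weightedConstQ_pos {c : ℝ} (hc : 0 < c) (θ η : ℝ) (f : ℂ → ℂ) (x₀ s hmax R Hs : ℝ) (B : ℕ) :
    0 < weightedConstQ c θ η f x₀ s hmax R Hs B :=
  div_pos hc (frameWeightQ_pos θ η f x₀ s hmax R Hs B)

theorem weightedConstQ_le {c : ℝ} (hc : 0 ≤ c) (θ η : ℝ) (f : ℂ → ℂ) (x₀ s hmax R Hs : ℝ) (B : ℕ) :
    weightedConstQ c θ η f x₀ s hmax R Hs B ≤ c :=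
  div_le_self hc (one_le_frameWeightQ θ η f x₀ s hmax R Hs B)

/-- (K) the socket is DOWNWARD-closed in the frame functional (pointwise on legal frames) and UPWARD-closed in the floor. -/
theorem lawWQ_mono {cF cF' : Budget} {L κ₀ κ₀' : ℝ}
    (hc : ∀ (η : ℝ) (f : ℂ → ℂ) (x₀ s hmax R Hs : ℝ) (B : ℕ), EngineHyps5 2 η f x₀ s hmax R Hs B →
      cF' η f x₀ s hmax R Hs B ≤ cF η f x₀ s hmax R Hs B)
    (hκ : κ₀ ≤ κ₀') (h : TouchedDissipationLawWQ cF L κ₀) : TouchedDissipationLawWQ cF' L κ₀' :=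
  fun η f x₀ s hmax R Hs B hE j v z hch hA hlow ht ha hfl =>
    (mul_le_mul_of_nonneg_right (hc η f x₀ s hmax R Hs B hE) (sq_nonneg s)).trans
      (h η f x₀ s hmax R Hs B hE j v z hch hA hlow ht ha (hκ.trans hfl))

/-- (K) a FRAME-BLIND constant implies the weighted law: `W(const c) → T⁗(c, θ)` for `0 ≤ c` (T‴, were it true, would give T⁗ — sanity only; T‴ is dead). -/
theorem lawTQ_of_const {c L κ₀ : ℝ} (hc : 0 ≤ c) (θ : ℝ) (h : TouchedDissipationLawWQ (fun _ _ _ _ _ _ _ _ => c) L κ₀) :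
    TouchedDissipationLawTQ c L κ₀ θ :=
  lawWQ_mono (fun η f x₀ s hmax R Hs B _ => weightedConstQ_le hc θ η f x₀ s hmax R Hs B) le_rfl h

/-- (K) T⁗ is DOWNWARD-closed in `c`, UPWARD-closed in `κ₀` and in `θ` (larger weight slope = weaker law), for `0 ≤ c'`. -/
theorem lawTQ_mono_theta {c c' L κ₀ κ₀' θ θ' : ℝ} (hc' : 0 ≤ c') (hcc : c' ≤ c) (hκ : κ₀ ≤ κ₀') (hθ : θ ≤ θ')
    (h : TouchedDissipationLawTQ c L κ₀ θ) : TouchedDissipationLawTQ c' L κ₀' θ' := by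
  refine lawWQ_mono (fun η f x₀ s hmax R Hs B _ => ?_) hκ h
  have hw := frameWeightQ_pos θ η f x₀ s hmax R Hs B
  calc weightedConstQ c' θ' η f x₀ s hmax R Hs B ≤ c' / frameWeightQ θ η f x₀ s hmax R Hs B :=
        div_le_div_of_nonneg_left hc' hw (frameWeightQ_mono hθ η f x₀ s hmax R Hs B)
    _ ≤ weightedConstQ c θ η f x₀ s hmax R Hs B := div_le_div_of_nonneg_right hcc hw.le

/-- (K) on a row of the socket with `0 < cF(F)` the energy drop is NON-NEGATIVE (the weight is squared). -/
theorem drop_nonneg_of_lawWQ {cF : Budget} {L κ₀ : ℝ} (h : TouchedDissipationLawWQ cF L κ₀)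
    {η : ℝ} {f : ℂ → ℂ} {x₀ s hmax R Hs : ℝ} {B : ℕ} (hE : EngineHyps5 2 η f x₀ s hmax R Hs B) (hcF : 0 < cF η f x₀ s hmax R Hs B)
    {j : ℕ} {v z : ℂ} (hch : Charged (PTrkSQ PBot) StTrkDQ ReadyR2 η f x₀ s hmax R Hs B j) (hA : ApproachLevelQ η f x₀ s hmax R Hs B j)
    (hlow : IsLowest StTrkDQ η f x₀ s hmax R Hs B j v) (ht : Touches f j v z) (ha : AtomicPair f j v z) (hfl : κ₀ ≤ v.im * stateKappa f j v) :
    0 ≤ (v.im ^ 2 + z.im ^ 2) - childEnergy f j (pairUnion v z) := by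
  have hs : 0 < s := hE.2.2.2.1
  have hrow := h η f x₀ s hmax R Hs B hE j v z hch hA hlow ht ha hfl
  by_contra hneg
  push Not at hneg
  have h0 : η ^ 2 * logWeight L Hs (v.im ^ 2 + z.im ^ 2) ^ 2 * ((v.im ^ 2 + z.im ^ 2) - childEnergy f j (pairUnion v z)) ≤ 0 :=
    mul_nonpos_of_nonneg_of_nonpos (by positivity) hneg.le
  nlinarith [mul_pos hcF (pow_pos hs 2)]

/-- (K) the weighted purse identity FIT_W reads: `1/c_F = w_F/c`. -/
theorem inv_weightedConstQ (c θ η : ℝ) (f : ℂ → ℂ) (x₀ s hmax R Hs : ℝ) (B : ℕ) :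
    1 / weightedConstQ c θ η f x₀ s hmax R Hs B = frameWeightQ θ η f x₀ s hmax R Hs B / c := by
  unfold weightedConstQ
  rw [one_div, inv_div]

end RhW08.TouchedDissipationW
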